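import Summits.AtomisticToContinuum.Crystallization.Theses.PricedLinkCensus

/-!
# Route `PricedLinkCensus`, crux `LocalToGlobal` (stmt-AtomisticToContinuum-14232),
# line `flux-cell-joint-census` — vocabulary and registered stub statements

`Defs` file of the crux line `flux-cell-joint-census`
(`Summits/AtomisticToContinuum/Crystallization/Cruxes/LocalToGlobal/Lines/flux_cell_joint_census.lean`,
line card `…/Lines/flux-cell-joint-census.md`, idea card `…/Ideas/flux-cell-joint-census.md`, triage
r1-1/2/3: pass; picked by the lead, `…/Cruxes/LocalToGlobal/PICKED.md`).  A `Cruxes/…/Lines/*.lean`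
skeleton is not an importable module, so the objects the line posits and the STATEMENTS of its four
registered stubs live here, to be imported verbatim by the stub files
`Theorems/PricedLinkCensusLocalToGlobal<Stub>.lean` (landed `--supports stmt-AtomisticToContinuum-14232`)
and by the closing composition `LocalToGlobal_of` of the skeleton.

THE LINE.  `r⁻⁶` on `ℝ³` is the Newton kernel of `ℝ⁸`.  Smear every particle into the uniform unit
charge on the 8-ball `B(ι yᵢ, nnᵢ/2)` (`ι : ℝ³ ⊂ ℝ⁸`; smearing is EXACT for the pair terms by Newton's
theorem, statement `NewtonShell8`), and bound the 8-D Coulomb energy from above by Thomson's principle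
with the flux of each charge CONFINED to the tube `Ωᵢ × ℝ⁵` over its truncated strict Voronoi cell
`Ωᵢ = Vor°ᵢ ∩ B(yᵢ, ρ₀ nnᵢ)`, wall flux prescribed by a square-integrable transfer field `G`
(statement `ConfinedThomson`): `Σ_{i≠j} r_ij⁻⁶ ≤ Σ_i fluxCell(Ωᵢ, yᵢ, nnᵢ/2; G)`.  Hence the full
Lennard-Jones energy dominates the sum of the PINNED first-shell site functionals
`λᵢ = (1/24) Σ_{0 < r_ij ≤ ρ₀ nnᵢ} r_ij⁻¹² − (1/12)·fluxCell(Ωᵢ, yᵢ, nnᵢ/2; G)`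
(`sum_siteFunctional_le_interactionEnergy`, proved here from the two analysis statements), and a priced
gap for `Σᵢ λᵢ` with a LOCAL transfer rule (statement `FluxCellPricedGap`, the hardest stub; it carries the
energetic content of the sibling crux `ChargedEnergyGap`, cf. `chargedEnergyGap_of`) closes the crux; the
fcc entry of the cell table (statement `FccMirrorExact`: pure confinement is exact on the rhombic
dodecahedron, all of whose facets are mirrors of the lattice) is the line's first checkable milestone.

Contents:
* the 8-D flux-tube objects (local version of definition request D1 of summit card
  `flux-tube-thomson-8d`): `emb`, `proj`, `tube`, `smearedPair`, `IsTest`, `admissible`, `tubeEnergy`,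
  `fluxCell`, `cell`, `env`, `transferField`, `siteFunctional`, `fccSet`;
* the statements of the line's four registered stubs as named, deliberately untagged `Prop`s (statements of
  a proof plan, not results in print; the audit's advisory `vendored-fact` class is expected until the stub
  files provide witnesses): `NewtonShell8` (stub_newtonShell8), `ConfinedThomson` (stub_confinedThomson),
  `FluxCellPricedGap` (stub_fluxCellPricedGap, held by the lead), `FccMirrorExact` (stub_fccMirrorExact);
* real proofs: `emb` is an isometric section of `proj`; cells are open, pairwise disjoint and contain the
  smearing balls; the localisation inequality `Σᵢ λᵢ ≤ E_LJ` from `NewtonShell8 ∧ ConfinedThomson`; the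
  composition `chargedEnergyGap_of` / `localToGlobal_of_statements` (sorry-free; axioms `propext`,
  `Classical.choice`, `Quot.sound`).

Conventions: `lennardJones r = r⁻¹²/12 − r⁻⁶/6` (tree), so `E = (1/24)ΣᵢΣ_{j≠i} r⁻¹² − (1/12)ΣᵢΣ_{j≠i} r⁻⁶`
(`two_mul_interactionEnergy`).  The Newton kernel of `ℝ⁸` is `‖z‖⁻⁶/(2π⁴)` (`|S⁷| = π⁴/3`), whence the
factor `2π⁴` in `fluxCell`.  Junk values: `nearestDist = 0` for a lone site makes its smearing ball empty,
its smeared charge the zero measure, `tubeEnergy = 0`, `fluxCell = 0`, `λ = 0`; `tubeEnergy` is an `sInf`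
(`sInf ∅ = 0`), so every consumer of `fluxCell` as an UPPER bound must exhibit an admissible field.

References: O. D. Kellogg, *Foundations of Potential Theory* (1929), Ch. III §3 (Newton's theorem for
spherical shells, any dimension via the mean value property); D. Gilbarg, N. S. Trudinger, *Elliptic PDE of
second order* (2001), Thm 2.1 (mean value; tree `Literature.Analysis.FluidPDE.integral_radial_mul_eq_of_laplacian_eq_zero`);
W. Thomson (Lord Kelvin) 1848 / Dirichlet principle for field energies, e.g. E. H. Lieb, M. Loss, *Analysis* (2001),
Ch. 9 (Coulomb energies, here transposed to `ℝ⁸`); the summit card `flux-tube-thomson-8d` (numerics `T(RD)`).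
-/

noncomputable section

open scoped BigOperators RealInnerProductSpace
open MeasureTheory Literature.MathematicalPhysics.StatisticalMechanics Literature.Geometry.DiscreteGeometry
open Summit.AtomisticToContinuum.Crystallization.Theses.PricedLinkCensus

namespace Summit.AtomisticToContinuum.Crystallization.Theorems.PricedLinkCensusLocalToGlobal

/-! ## The 8-D flux-tube objects (definition request D1 of card flux-tube-thomson-8d, local version) -/

/-- Euclidean 3-space (configurations live here). [folklore] -/
abbrev E3 := EuclideanSpace ℝ (Fin 3)

/-- Euclidean 8-space, where `‖z‖⁻⁶` is (2π⁴ times) the Newton kernel. [folklore] -/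
abbrev E8 := EuclideanSpace ℝ (Fin 8)

/-- `ι : ℝ³ ⊂ ℝ⁸`, the first three coordinates. [folklore] -/
def emb (x : E3) : E8 := WithLp.toLp 2 fun k => if h : (k : ℕ) < 3 then x ⟨k, h⟩ else 0

/-- the projection `ℝ⁸ → ℝ³` onto the first three coordinates (`proj ∘ emb = id`). [folklore] -/
def proj (z : E8) : E3 := WithLp.toLp 2 fun k => z (k.castLE (by norm_num))

/-- the flux tube `Ω × ℝ⁵ ⊂ ℝ⁸` over a cell `Ω ⊂ ℝ³`. [folklore] -/
def tube (Ω : Set E3) : Set E8 := proj ⁻¹' Ω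

/-- SMEARED PAIR KERNEL: the `‖z − w‖⁻⁶` interaction of the two uniform unit charges on the 8-balls
`B(ι a, ε)` and `B(ι b, δ)` (double ball average w.r.t. Lebesgue measure on `ℝ⁸`; junk `0` if a radius
is `≤ 0`).  With `a = b`, `ε = δ` it is the SELF-ENERGY of one smeared charge (a dimensional constant
times `ε⁻⁶`; finite since `6 < 8`). [folklore] -/
def smearedPair (a b : E3) (ε δ : ℝ) : ℝ :=
  ⨍ z in Metric.ball (emb a) ε, ⨍ w in Metric.ball (emb b) δ, ‖z - w‖⁻¹ ^ 6

/-- test functions of the weak formulation: `C¹` with compact support on `ℝ⁸`. [folklore] -/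
def IsTest (φ : E8 → ℝ) : Prop := ContDiff ℝ 1 φ ∧ HasCompactSupport φ

/-- ADMISSIBLE CONFINED FLUXES for the cell `Ω`, the charge smeared on `B(ι x, ε)` and the transfer
field `G`: square-integrable vector fields `F` on `ℝ⁸` vanishing off the tube `Ω × ℝ⁵` with, weakly,
`div F = (uniform probability on B(ι x, ε))` inside the tube and wall flux `F·n = G·n` on `∂Ω × ℝ⁵`
— both encoded by `∫_{tube} ⟪F − G, ∇φ⟫ = −⨍_{ball} φ` for every test `φ` (flux may escape to
transverse infinity, so there is no compatibility condition; finite energy needs `≥ 3` transverse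
dimensions, here `5`).  `G = 0` is pure confinement (the card's `q = 0`). [folklore] -/
def admissible (Ω : Set E3) (x : E3) (ε : ℝ) (G : E8 → E8) : Set (E8 → E8) :=
  {F | MemLp F 2 volume ∧ (∀ z, z ∉ tube Ω → F z = 0) ∧
    ∀ φ : E8 → ℝ, IsTest φ →
      ∫ z in tube Ω, ⟪F z - G z, gradient φ z⟫ = - ⨍ z in Metric.ball (emb x) ε, φ z}

/-- the confined field energy `inf ∫ ‖F‖²` over admissible fluxes (THOMSON functional of the tube;
`sInf ∅ = 0`). [folklore] -/
def tubeEnergy (Ω : Set E3) (x : E3) (ε : ℝ) (G : E8 → E8) : ℝ :=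
  sInf ((fun F : E8 → E8 => ∫ z, ‖F z‖ ^ 2) '' admissible Ω x ε G)

/-- THE FLUX-CELL FUNCTIONAL `T(Ω, x, ε; G) = 2π⁴ · tubeEnergy − self-energy`: the cell's share of the
`r⁻⁶` double sum (card flux-tube-thomson-8d: `Σ_{i≠j} r_ij⁻⁶ ≤ Σ_i T(Ω_i, x_i)`, equality iff the wall
data are the true 8-D flux; antitone in `Ω` at `G = 0`; scales like `length⁻⁶`; independent of `ε` as
long as the ball lies in the cell, by the mean value property). [folklore] -/
def fluxCell (Ω : Set E3) (x : E3) (ε : ℝ) (G : E8 → E8) : ℝ :=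
  2 * Real.pi ^ 4 * tubeEnergy Ω x ε G - smearedPair x x ε ε

variable {N : ℕ}

/-- the TRUNCATED STRICT VORONOI CELL `Vor°ᵢ ∩ B(yᵢ, ρ₀·nnᵢ)` of site `i` (open, pairwise disjoint,
contains `B(yᵢ, nnᵢ/2)` once `ρ₀ ≥ 1`; read off the sites within `2ρ₀·nnᵢ`). [folklore] -/
def cell (ρ₀ : ℝ) (y : Fin N → E3) (i : Fin N) : Set E3 :=
  {z | dist z (y i) < ρ₀ * nearestDist y i ∧ ∀ j, j ≠ i → dist z (y i) < dist z (y j)}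

/-- the LOCAL ENVIRONMENT of site `i`: the finite point set of sites within `ρ₁·nnᵢ` (the only input of
the transfer rule). [folklore] -/
def env (ρ₁ : ℝ) (y : Fin N → E3) (i : Fin N) : Finset E3 :=
  (Finset.univ.filter fun j => dist (y j) (y i) ≤ ρ₁ * nearestDist y i).image y

/-- the TRANSFER FIELD of a configuration: superposition of the local rule's outputs
`G_y = Σᵢ Grule(envᵢ, yᵢ)` (the card's typed facet flux `q`, realised as wall data `G·n`; by linearity
a sum of local contributions is again a transfer field). [folklore] -/
def transferField (ρ₁ : ℝ) (Grule : Finset E3 → E3 → E8 → E8) (y : Fin N → E3) : E8 → E8 :=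
  fun z => ∑ i, Grule (env ρ₁ y i) (y i) z

/-- THE PINNED SITE FUNCTIONAL `λᵢ = (1/24) Σ_{j ≠ i, r_ij ≤ ρ₀ nnᵢ} r_ij⁻¹² − (1/12)·fluxCell(cellᵢ, yᵢ, nnᵢ/2; G_y)`:
truncated half-pair repulsion plus flux-cell attraction credit.  At a bulk site of a perfect Barlow
crystal with exact wall data it equals the site's half-pair Lennard-Jones lattice sum. [folklore] -/
def siteFunctional (ρ₀ ρ₁ : ℝ) (Grule : Finset E3 → E3 → E8 → E8) (y : Fin N → E3) (i : Fin N) : ℝ :=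
  (1 / 24) * (∑ j ∈ (Finset.univ.erase i).filter (fun j => dist (y i) (y j) ≤ ρ₀ * nearestDist y i),
      (dist (y i) (y j))⁻¹ ^ 12)
    - (1 / 12) * fluxCell (cell ρ₀ y i) (y i) (nearestDist y i / 2) (transferField ρ₁ Grule y)

/-- the FACE-CENTRED CUBIC point set with nearest-neighbour distance `a` through the origin:
`(a/√2)·{n ∈ ℤ³ : n₁ + n₂ + n₃ even}` (its Voronoi cell is the rhombic dodecahedron, inradius `a/2`,
circumradius `a/√2`; all twelve facet planes are mirror planes of the set). [folklore] -/
def fccSet (a : ℝ) : Set E3 :=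
  {p | ∃ n : Fin 3 → ℤ, Even (∑ k, n k) ∧ p = (a / Real.sqrt 2) • WithLp.toLp 2 fun k => (n k : ℝ)}

/-! ## The four stub statements -/

/-- `NewtonShell8`, the statement of `stub_newtonShell8` — NEWTON'S SHELL THEOREM IN `ℝ⁸` (card flux-tube-thomson-8d P1,
"Newton's theorem makes smearing EXACT"): for two disjoint 8-balls centred on `ι(ℝ³)`, the smeared
`‖z − w‖⁻⁶` interaction equals the point interaction `(dist a b)⁻⁶` — the mean value property of the
harmonic function `‖·‖⁻⁶` on `ℝ⁸ ∖ {0}`, applied twice, plus `dist (ι a) (ι b) = dist a b`.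
Size M (Mathlib has no mean value property for harmonic functions on `ℝⁿ`; divergence theorem on balls
or a direct polar-coordinate computation).  Leans on: Mathlib measure theory only. -/
def NewtonShell8 : Prop :=
  ∀ (a b : E3) (ε δ : ℝ), 0 < ε → 0 < δ → ε + δ ≤ dist a b →
    smearedPair a b ε δ = (dist a b)⁻¹ ^ 6

/-- `ConfinedThomson`, the statement of `stub_confinedThomson` — CONFINED THOMSON INEQUALITY WITH FREE TRANSFER (card
flux-tube-thomson-8d P1 = FluxTubeBound ★, in the form the line consumes): for pairwise disjoint
OPEN cells `Ωᵢ ⊂ ℝ³` containing the smearing balls `B(xᵢ, εᵢ)`, and ANY square-integrable transfer field `G`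
that is weakly divergence-free relative to the union of the tubes (`∫_{∪ tubes} ⟪G, ∇φ⟫ = 0`: no sources,
tangent at the outer boundary), the smeared pair interactions are dominated by the flux cells:
`Σᵢ Σ_{j≠i} smearedPair(xᵢ,xⱼ,εᵢ,εⱼ) ≤ Σᵢ fluxCell(Ωᵢ, xᵢ, εᵢ; G)`.  Proof plan: glue admissible
`Fᵢ`; by disjointness and the hypothesis on `G`, `Σ Fᵢ` has weak divergence `μ = Σ νᵢ` on `ℝ⁸`;
Thomson/Dirichlet: `∫‖Σ Fᵢ‖² ≥ ∫‖∇(Φ∗μ)‖² = (2π⁴)⁻¹ ∬‖z−w‖⁻⁶ dμ dμ`; expand bilinearly and subtract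
the self terms; admissible sets are non-empty (explicit transverse escape flux inside `B(xᵢ,εᵢ) × ℝ⁵`
plus `G`), degenerate radii `εᵢ ≤ 0` contribute `0 ≤ 0`.  Size L (H(div)-type bookkeeping with `L²`
fields and `C¹_c` tests; local integrability of `‖·‖⁻⁶` in `ℝ⁸`; no Mathlib Thomson principle).
Leans on: Mathlib (Bochner integral, `MemLp`, `gradient`). -/
def ConfinedThomson : Prop :=
  ∀ (N : ℕ) (x : Fin N → E3) (Ω : Fin N → Set E3) (ε : Fin N → ℝ) (G : E8 → E8),
    (∀ i, IsOpen (Ω i)) →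
    (∀ i j, i ≠ j → Disjoint (Ω i) (Ω j)) →
    (∀ i, Metric.ball (x i) (ε i) ⊆ Ω i) →
    MemLp G 2 volume →
    (∀ φ : E8 → ℝ, IsTest φ → ∫ z in tube (⋃ i, Ω i), ⟪G z, gradient φ z⟫ = 0) →
    ∑ i, ∑ j ∈ Finset.univ.erase i, smearedPair (x i) (x j) (ε i) (ε j) ≤
      ∑ i, fluxCell (Ω i) (x i) (ε i) G

/-- `FluxCellPricedGap`, the statement of `stub_fluxCellPricedGap` — THE FLUX-CELL PRICED GAP (the card's joint census = card
flux-tube-thomson-8d K1 with `D_{R,η} ↦ #charged(1/100)` and `e(hcp*) ↦ e*`; HARDEST, XL): there are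
radii `ρ₀ ≥ 1` (cell truncation), `ρ₁` (rule input), `ρ₂` (rule support), constants `κ > 0`, `C`, and a
LOCAL TRANSFER RULE `Grule : (environment, centre) ↦ vector field on ℝ⁸` such that for every finite
injective configuration (i) the transfer field `G_y = Σᵢ Grule(envᵢ, yᵢ)` is square-integrable, weakly
divergence-free relative to the union of the cell tubes, and each summand is supported within `ρ₂·nnᵢ`
of its centre (3-D projection) — the hypotheses `stub_confinedThomson` consumes, plus locality — and
(ii) the pinned site functionals satisfy `N·e* + κ·#charged(y) − C·N^{2/3} ≤ Σᵢ λᵢ(y)`.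
Content: exactness of the local wall-flux rule on the Lennard-Jones periodic minimiser family (the bet:
hcp `(a, c/a)` and fcc — fcc Voronoi cells are mirror-complete so `G = 0` is exact there; hcp's six
inclined facets are not mirrors, `σ_h ≈ 2.7e−6 > 0` at `G = 0`, so the rule must supply the true hcp
facet flux as a function of the cell), quadratic domination of the confinement loss by the phonon cost
near it (jitterbug falsifier), and the Hales-type one-centre inequality with transfers for `λ` over the
census's finite case lattice (ico/FK cells credited only `+2.4 %` in `T`; raw one-centre value `5.9 %`
low — `TetrahedralFrustrationNarrow` evasion (i)).  Why it might fail: a periodic configuration with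
mean `λ` below `e*` for every local rule of bounded radii (e.g. if the LJ minimiser is a long-period
Barlow word the rule is not exact on), or second-order jitterbug credit exceeding the routable phonon
cost at every radius.  Leans on: `IsChargeFree`, `nearestDist` (BondGraph), `PeriodicConfiguration`
(tree); SoftFourRings (14234, open) for the case analysis; sibling `chargedEnergyGap_iff_noBoundary`
says `C = 0` w.l.o.g. -/
def FluxCellPricedGap : Prop :=
  ∃ (ρ₀ ρ₁ ρ₂ κ C : ℝ) (Grule : Finset E3 → E3 → E8 → E8), 1 ≤ ρ₀ ∧ 0 < κ ∧
    (∀ (N : ℕ) (y : Fin N → E3), Function.Injective y →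
      MemLp (transferField ρ₁ Grule y) 2 volume ∧
      (∀ φ : E8 → ℝ, IsTest φ →
        ∫ z in tube (⋃ i, cell ρ₀ y i), ⟪transferField ρ₁ Grule y z, gradient φ z⟫ = 0) ∧
      (∀ (i : Fin N) (z : E8), Grule (env ρ₁ y i) (y i) z ≠ 0 →
        dist (proj z) (y i) < ρ₂ * nearestDist y i)) ∧
    ∀ (N : ℕ) (y : Fin N → E3), Function.Injective y →
      (N : ℝ) * (⨅ Q : PeriodicConfiguration 3, Q.energyPerParticle lennardJones) +
          κ * (Nat.card {i : Fin N // ¬ IsChargeFree (1 / 100 : ℝ) y i} : ℝ) -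
          C * (N : ℝ) ^ (2 / 3 : ℝ) ≤
        ∑ i, siteFunctional ρ₀ ρ₁ Grule y i

/-- `FccMirrorExact`, the statement of `stub_fccMirrorExact` — MIRROR EXACTNESS AT fcc WITH ZERO
TRANSFER (card flux-tube-thomson-8d P2 `MirrorEquality`, instance fcc; the FIRST CHECKABLE MILESTONE of
the line and the sanity check of the definitions above, cf. triage r1-1/r1-2; not consumed by
`LocalToGlobal_of`): if an injective configuration coincides with the fcc lattice of spacing `a` within
`3ρ₀·a` of the site `i`, then the pure-confinement flux cell of `i` (truncated strict Voronoi cell = the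
open rhombic dodecahedron, smearing radius `nnᵢ/2 = a/2`, `G = 0`) equals EXACTLY the site's `r⁻⁶`
lattice sum `Σ_{p ∈ fcc(a) ∖ 0} ‖p‖⁻⁶` (`= S₆(fcc)·a⁻⁶`, `S₆(fcc) = 14.45392…`; the card's numerics:
`T(RD) = 14.4539309` vs `14.4539200`).  Proof plan: the field `E_∞ = Σ_{p ∈ fcc} E_p` of the infinite
lattice of smeared charges converges absolutely in `ℝ⁸` (`|E_p| ~ r⁻⁷` over a 3-D lattice), is a
gradient, has divergence `νᵢ` in the tube and ZERO normal component on every facet plane `× ℝ⁵`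
(each is a mirror of the lattice), hence is THE confined minimiser; its energy is `⨍_{ballᵢ} u_∞`, and
Newton's theorem turns the cross terms into the lattice sum.  For hcp the analogue is FALSE at `G = 0`
(inclined facets are not mirrors; Holmgren), which is why `FluxCellPricedGap` carries a transfer rule.
Size M/L.  Leans on: `NewtonShell8`; tree `Literature.Analysis.FluidPDE.integral_radial_mul_harmonic`
(mean value technique), Mathlib `InnerProductSpace.HarmonicOnNhd`. -/
def FccMirrorExact : Prop :=
  ∀ (a ρ₀ : ℝ), 0 < a → 1 ≤ ρ₀ → ∀ (N : ℕ) (y : Fin N → E3) (i : Fin N), Function.Injective y →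
    (∀ j, dist (y j) (y i) ≤ 3 * ρ₀ * a → y j - y i ∈ fccSet a) →
    (∀ p ∈ fccSet a, ‖p‖ ≤ 3 * ρ₀ * a → ∃ j, y j = y i + p) →
    fluxCell (cell ρ₀ y i) (y i) (nearestDist y i / 2) (fun _ => 0) =
      ∑' p : {p : E3 // p ∈ fccSet a ∧ p ≠ 0}, ‖(p : E3)‖⁻¹ ^ 6

/-! ## The embedding `ℝ³ ⊂ ℝ⁸` is an isometric section of `proj` (real proofs) -/

/-- `proj ∘ emb = id`. [folklore] -/
theorem proj_emb (x : E3) : proj (emb x) = x := by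
  ext k
  simp [proj, emb, Fin.castLE]

/-- `emb` is additive on differences. [folklore] -/
theorem emb_sub (a b : E3) : emb a - emb b = emb (a - b) := by
  ext k
  simp only [emb, PiLp.sub_apply]
  by_cases h : (k : ℕ) < 3 <;> simp [h]

/-- `emb` preserves the norm … [folklore] -/
theorem norm_emb (x : E3) : ‖emb x‖ = ‖x‖ := by
  rw [EuclideanSpace.norm_eq, EuclideanSpace.norm_eq]
  congr 1
  rw [Fin.sum_univ_eight, Fin.sum_univ_three]
  simp [emb]

/-- … hence distances: the smearing balls of two sites of `ℝ³` are `dist a b` apart in `ℝ⁸`. [folklore] -/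
theorem dist_emb (a b : E3) : dist (emb a) (emb b) = dist a b := by
  rw [dist_eq_norm, dist_eq_norm, emb_sub, norm_emb]

/-! ## Elementary geometry of the cells (real proofs) -/

/-- In an injective configuration with a second site, the own nearest-neighbour distance is positive. [folklore] -/
theorem nearestDist_pos_of_ne {y : Fin N → E3} (hy : Function.Injective y) {i k : Fin N} (hk : k ≠ i) :
    0 < nearestDist y i := by
  obtain ⟨k₀, hk₀, h⟩ := exists_nearestDist_eq_dist y ⟨k, hk⟩
  rw [h]
  exact dist_pos.2 fun e => hk₀ (hy e).symm

/-- Strict Voronoi cells (truncated or not) are pairwise disjoint. [folklore] -/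
theorem cell_disjoint (ρ₀ : ℝ) (y : Fin N → E3) :
    ∀ i j, i ≠ j → Disjoint (cell ρ₀ y i) (cell ρ₀ y j) := by
  intro i j hij
  refine Set.disjoint_left.2 fun z hzi hzj => ?_
  exact lt_asymm (hzi.2 j (Ne.symm hij)) (hzj.2 i hij)

/-- Truncated strict Voronoi cells are open. [folklore] -/
theorem isOpen_cell (ρ₀ : ℝ) (y : Fin N → E3) (i : Fin N) : IsOpen (cell ρ₀ y i) := by
  have h1 : IsOpen {z : E3 | dist z (y i) < ρ₀ * nearestDist y i} :=
    isOpen_lt (continuous_id.dist continuous_const) continuous_const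
  have h2 : IsOpen (⋂ j : Fin N, {z : E3 | j ≠ i → dist z (y i) < dist z (y j)}) := by
    refine isOpen_iInter_of_finite fun j => ?_
    by_cases hj : j = i
    · simp [hj]
    · simp only [ne_eq, hj, not_false_eq_true, forall_const]
      exact isOpen_lt (continuous_id.dist continuous_const) (continuous_id.dist continuous_const)
  have h3 : cell ρ₀ y i = {z : E3 | dist z (y i) < ρ₀ * nearestDist y i} ∩
      ⋂ j : Fin N, {z : E3 | j ≠ i → dist z (y i) < dist z (y j)} := by
    ext z
    simp [cell, Set.mem_iInter]
  rw [h3]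
  exact h1.inter h2

/-- The smearing ball `B(yᵢ, nnᵢ/2)` lies in the truncated strict Voronoi cell once `ρ₀ ≥ 1`. [folklore] -/
theorem ball_subset_cell {ρ₀ : ℝ} (hρ₀ : 1 ≤ ρ₀) (y : Fin N → E3) (i : Fin N) :
    Metric.ball (y i) (nearestDist y i / 2) ⊆ cell ρ₀ y i := by
  intro z hz
  rw [Metric.mem_ball] at hz
  have hnn := nearestDist_nonneg y i
  refine ⟨lt_of_lt_of_le hz (by nlinarith), fun j hj => ?_⟩
  have h1 : nearestDist y i ≤ dist (y i) (y j) := nearestDist_le_dist y hj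
  have h2 : dist (y i) (y j) ≤ dist (y i) z + dist z (y j) := dist_triangle _ _ _
  rw [dist_comm (y i) z] at h2
  linarith

/-! ## The localisation inequality `Σᵢ λᵢ ≤ E_LJ` from the two analysis stubs -/

/-- DOMINATION OF THE TAIL: `Σᵢ Σ_{j≠i} r_ij⁻⁶ ≤ Σᵢ fluxCell(cellᵢ, yᵢ, nnᵢ/2; G_y)` for every
injective configuration whose transfer field satisfies the two hypotheses of the Thomson stub. [folklore] -/
theorem sum_inv_pow_six_le_sum_fluxCell (hN : NewtonShell8) (hT : ConfinedThomson)
    {ρ₀ ρ₁ : ℝ} (hρ₀ : 1 ≤ ρ₀) (Grule : Finset E3 → E3 → E8 → E8) {y : Fin N → E3}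
    (hy : Function.Injective y) (hmem : MemLp (transferField ρ₁ Grule y) 2 volume)
    (hdiv : ∀ φ : E8 → ℝ, IsTest φ →
      ∫ z in tube (⋃ i, cell ρ₀ y i), ⟪transferField ρ₁ Grule y z, gradient φ z⟫ = 0) :
    ∑ i, ∑ j ∈ Finset.univ.erase i, (dist (y i) (y j))⁻¹ ^ 6 ≤
      ∑ i, fluxCell (cell ρ₀ y i) (y i) (nearestDist y i / 2) (transferField ρ₁ Grule y) := by
  have h1 : ∑ i, ∑ j ∈ Finset.univ.erase i, (dist (y i) (y j))⁻¹ ^ 6 =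
      ∑ i, ∑ j ∈ Finset.univ.erase i,
        smearedPair (y i) (y j) (nearestDist y i / 2) (nearestDist y j / 2) := by
    refine Finset.sum_congr rfl fun i _ => Finset.sum_congr rfl fun j hj => ?_
    have hji : j ≠ i := (Finset.mem_erase.1 hj).1
    have hd1 : nearestDist y i ≤ dist (y i) (y j) := nearestDist_le_dist y hji
    have hd2 : nearestDist y j ≤ dist (y j) (y i) := nearestDist_le_dist y hji.symm
    rw [dist_comm (y j) (y i)] at hd2
    rw [hN (y i) (y j) _ _ (half_pos (nearestDist_pos_of_ne hy hji))
      (half_pos (nearestDist_pos_of_ne hy hji.symm)) (by linarith)]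
  rw [h1]
  exact hT N y (cell ρ₀ y) (fun i => nearestDist y i / 2) (transferField ρ₁ Grule y)
    (fun i => isOpen_cell ρ₀ y i) (cell_disjoint ρ₀ y) (fun i => ball_subset_cell hρ₀ y i) hmem hdiv

/-- LOCALISATION: the Lennard-Jones energy dominates the sum of the pinned site functionals. [folklore] -/
theorem sum_siteFunctional_le_interactionEnergy (hN : NewtonShell8)
    (hT : ConfinedThomson) {ρ₀ ρ₁ : ℝ} (hρ₀ : 1 ≤ ρ₀) (Grule : Finset E3 → E3 → E8 → E8)
    {y : Fin N → E3} (hy : Function.Injective y) (hmem : MemLp (transferField ρ₁ Grule y) 2 volume)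
    (hdiv : ∀ φ : E8 → ℝ, IsTest φ →
      ∫ z in tube (⋃ i, cell ρ₀ y i), ⟪transferField ρ₁ Grule y z, gradient φ z⟫ = 0) :
    ∑ i, siteFunctional ρ₀ ρ₁ Grule y i ≤ interactionEnergy lennardJones y := by
  -- the tail is dominated by the flux cells
  have hdom := sum_inv_pow_six_le_sum_fluxCell hN hT hρ₀ Grule hy hmem hdiv
  -- the energy, double counted and split into repulsion and attraction
  have hE : 2 * interactionEnergy lennardJones y =
      ∑ i, ∑ j ∈ Finset.univ.erase i,
        ((1 / 12) * (dist (y i) (y j))⁻¹ ^ 12 - (1 / 6) * (dist (y i) (y j))⁻¹ ^ 6) := by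
    rw [two_mul_interactionEnergy]
    rfl
  have hsplit : ∑ i, ∑ j ∈ Finset.univ.erase i,
        ((1 / 12) * (dist (y i) (y j))⁻¹ ^ 12 - (1 / 6) * (dist (y i) (y j))⁻¹ ^ 6) =
      (1 / 12) * ∑ i, ∑ j ∈ Finset.univ.erase i, (dist (y i) (y j))⁻¹ ^ 12 -
        (1 / 6) * ∑ i, ∑ j ∈ Finset.univ.erase i, (dist (y i) (y j))⁻¹ ^ 6 := by
    simp only [Finset.sum_sub_distrib, Finset.mul_sum]
  -- dropping far repulsion only lowers the functional
  have hrep : ∑ i, ∑ j ∈ (Finset.univ.erase i).filter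
        (fun j => dist (y i) (y j) ≤ ρ₀ * nearestDist y i), (dist (y i) (y j))⁻¹ ^ 12 ≤
      ∑ i, ∑ j ∈ Finset.univ.erase i, (dist (y i) (y j))⁻¹ ^ 12 :=
    Finset.sum_le_sum fun i _ =>
      Finset.sum_le_sum_of_subset_of_nonneg (Finset.filter_subset _ _) fun j _ _ => by positivity
  -- assemble
  have hsum : ∑ i, siteFunctional ρ₀ ρ₁ Grule y i =
      (1 / 24) * ∑ i, ∑ j ∈ (Finset.univ.erase i).filter
          (fun j => dist (y i) (y j) ≤ ρ₀ * nearestDist y i), (dist (y i) (y j))⁻¹ ^ 12 -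
        (1 / 12) * ∑ i, fluxCell (cell ρ₀ y i) (y i) (nearestDist y i / 2)
          (transferField ρ₁ Grule y) := by
    simp only [siteFunctional, Finset.sum_sub_distrib, Finset.mul_sum]
  rw [hsum]
  linarith [hE, hsplit, hrep, hdom]

/-! ## The composition: the stubs prove the crux BY NAME -/

/-- The consequent alone: Newton smearing + confined Thomson + the flux-cell priced gap prove
`ChargedEnergyGap` (sibling crux 14231, to which triage r1-3 re-points this line).  Sorry-free. [folklore] -/
theorem chargedEnergyGap_of (hN : NewtonShell8) (hT : ConfinedThomson)
    (hP : FluxCellPricedGap) : ChargedEnergyGap := by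
  obtain ⟨ρ₀, ρ₁, ρ₂, κ, C, Grule, hρ₀, hκ, hstruct, hgap⟩ := hP
  refine ⟨κ, C, hκ, fun N y hy => (hgap N y hy).trans ?_⟩
  obtain ⟨hmem, hdiv, -⟩ := hstruct N y hy
  exact sum_siteFunctional_le_interactionEnergy hN hT hρ₀ Grule hy hmem hdiv

/-- Registered sub-goal `chargedEnergyGap_of_statements` (the composition in curried form): Newton
smearing, confined Thomson and the flux-cell priced gap prove the sibling crux `ChargedEnergyGap`.
[folklore] -/
theorem chargedEnergyGap_of_statements :
    NewtonShell8 → ConfinedThomson → FluxCellPricedGap → ChargedEnergyGap :=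
  fun hN hT hP => chargedEnergyGap_of hN hT hP

/-- The composition as an implication between NAMED statements (sorry-free; its axiom closure is
`propext, Classical.choice, Quot.sound`): the three stub statements prove the crux.  The antecedent
`TruncatedCensusGap` is not consumed — in this line the census is a template (cf. Disproof
`localToGlobal_of_chargedEnergyGap`). [folklore] -/
theorem localToGlobal_of_statements (hN : NewtonShell8) (hT : ConfinedThomson)
    (hP : FluxCellPricedGap) : TruncatedCensusGap → ChargedEnergyGap :=
  fun _ => chargedEnergyGap_of hN hT hP

end Summit.AtomisticToContinuum.Crystallization.Theorems.PricedLinkCensusLocalToGlobal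

end
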